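import Summits.RiemannHypothesis.RiemannHypothesis.Theorems.Splittings.JensenX4NewmanDeriv

/-!
# FAR PAIRS: the zeros of `H_t′` (`t < 0`) produced by the Dobner route lie ARBITRARILY DEEP (jen-neg g5, depth form of `newmanDeriv`)

Cell rh-split, seat rh-split-jen-neg g5 (brief sha16 f79c5f09d8bcb036), card `run/shared/lean/pub/rh-split/cards/SPLIT-jen-neg.md`
ADDENDUM 6; kernel `HOME/rh-split-jen-neg/g5/SketchG5FarPairs.lean` sha16 01c99a7056504b47 (= g4's `SketchG4Newman` 3c5fe060,
landed as `Splittings/JensenX4NewmanDerivStrip.lean` p492531 + `Splittings/JensenX4NewmanDeriv.lean` p492780, with ONE strengthening: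
the assembly T2 re-run with a free depth parameter `M`).  Referee rh-split-ref g3 replay PASS + label audit 2026-08-27T05:21:06Z;
lead rh-split-lead g3 RULING #22/#22a (vii)(β′); filed by rh-split-typer-2 g4 as a zero-def follow-up importing the landed files
(the three new decl blocks verbatim — `deriv_zero_im_lt_of` ll. 208–312, `deriv_deBruijnH_zero_im_lt`, `deriv_deBruijnH_zeros_im_unbounded`
ll. 651–668 — with one docstring added where the scratch had none; `newmanDeriv_of`/`newmanDeriv` are NOT re-landed, cite
`JensenX4NewmanDeriv.newmanDeriv`).

* `deriv_zero_im_lt_of` — T2 with depth: from the two analytic inputs (growth of `γ_t′/γ_t` on vertical strips; the differentiated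
  Dobner Theorem 4) for every `M` a zero `z` of `(H_t)′` with `Im z < −M` (`Im z = 1 − 2 Re J_t(s)` and
  `Re J_t(s) = Re s + (|t|/4) log|s/2π| → ∞` up a fixed strip);
* `deriv_deBruijnH_zero_im_lt : ∀ t < 0, ∀ M, ∃ z, deriv (deBruijnH t) z = 0 ∧ z.im < −M` — FAR PAIRS: the kernel's witnesses of
  `Λ^{(1)} ≥ 0` lie arbitrarily deep below the real axis (inputs discharged by the landed `dobnerGammaT_deriv_growth`,
  `xiDeformed_deriv_approx`);
* `deriv_deBruijnH_zeros_im_unbounded` — the imaginary parts of the zeros of `(H_t)′` are unbounded.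

Reading for X-4 (`RH ⟺ RowsFromOne ∧ RowZeroLaguerre`): the known witnesses against `A` off `t = 0` are FAR pairs (B-blind in the
g2/g3 dictionary); «B Newman-critical for ξ» stays UNDECIDED (card ADDENDUM 6 census).  LABELS (referee g3): RH-FREE kernel theorems
about `H_t`, `t < 0`; labels of record for (jen, neg) unchanged.  Nothing here is a claim about the truth of RH.

HONEST LABEL: «SPLITTING SEARCH over kernel-typed RH-EQUIVALENCES; a splitting A ∧ B ⟹ RH is CONDITIONAL bookkeeping unless A and B are
both proved; nothing here bears on the truth of RH.»
-/

set_option linter.dupNamespace false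

noncomputable section

open Complex Filter Set Topology Metric

namespace Summit.RiemannHypothesis.RiemannHypothesis.Theorems.Splittings.JensenX4NewmanDerivDepth

open Literature Literature.NumberTheory.LFunctions
open Summit.RiemannHypothesis.RiemannHypothesis.Theorems.Splittings.JensenX4NewmanDeriv

/-- **T2 with a depth parameter (jen-neg g5).** From the two analytic inputs of the Dobner route — growth of `γ_t′/γ_t` up every
vertical strip and the differentiated Theorem 4 `(ξ_t∘J_t)′ = γ_t′(ζ_t + o(1))` — for every `t < 0` and every `M` there is a zero `z`
of `(H_t)′` with `Im z < −M` (g4's `newmanDeriv_of` is the case `M = 0`). RH-FREE. -/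
theorem deriv_zero_im_lt_of {t : ℝ} (ht : t < 0)
    (hgrowth : ∀ a b : ℝ, a ≤ b → ∀ K : ℝ, ∃ y₁ : ℝ, 0 < y₁ ∧ ∀ s : ℂ, a ≤ s.re → s.re ≤ b →
      y₁ ≤ s.im → K * ‖dobnerGammaT t s‖ ≤ ‖deriv (dobnerGammaT t) s‖)
    (happD : ∀ a b : ℝ, a ≤ b → ∀ ε : ℝ, 0 < ε → ∃ y₀ : ℝ, ∀ s : ℂ, a ≤ s.re → s.re ≤ b →
      y₀ ≤ s.im → ‖deriv (fun s ↦ xiDeformed t (dobnerJ t s)) s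
        - deriv (dobnerGammaT t) s * zetaDeformed t s‖ ≤ ε * ‖deriv (dobnerGammaT t) s‖)
    (M : ℝ) : ∃ z : ℂ, deriv (deBruijnH t) z = 0 ∧ z.im < -M := by
  have ht' : 0 < |t| := abs_pos.2 ht.ne
  set F : ℂ → ℂ := fun s ↦ xiDeformed t (dobnerJ t s) with hF
  set G : ℂ → ℂ := fun s ↦ deriv F s / deriv (dobnerGammaT t) s with hGdef
  -- open upper half-plane: `F`, `γ_t` analytic, hence so are their derivatives
  have hU : IsOpen {s : ℂ | 0 < s.im} := isOpen_lt continuous_const Complex.continuous_im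
  have hFan : AnalyticOnNhd ℂ F {s : ℂ | 0 < s.im} := by
    refine DifferentiableOn.analyticOnNhd (fun s hs ↦ ?_) hU
    exact (((differentiable_xiDeformed t) _).comp s (differentiableAt_dobnerJ t hs)).differentiableWithinAt
  have hγan : AnalyticOnNhd ℂ (dobnerGammaT t) {s : ℂ | 0 < s.im} :=
    DifferentiableOn.analyticOnNhd (fun s hs ↦ (differentiableAt_dobnerGammaT t hs).differentiableWithinAt) hU
  have hF'an := hFan.deriv_of_isOpen hU
  have hγ'an := hγan.deriv_of_isOpen hU
  -- `γ_t′ ≠ 0` high up in any strip (growth with `K = 1`)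
  have hγ'ne : ∀ a b : ℝ, a ≤ b → ∃ y₁ : ℝ, 0 < y₁ ∧ ∀ s : ℂ, a ≤ s.re → s.re ≤ b → y₁ ≤ s.im →
      deriv (dobnerGammaT t) s ≠ 0 := by
    intro a b hab
    obtain ⟨y₁, hy₁, h⟩ := hgrowth a b hab 1
    refine ⟨y₁, hy₁, fun s h1 h2 h3 h0 ↦ ?_⟩
    have := h s h1 h2 h3
    rw [h0, norm_zero, one_mul] at this
    exact (dobnerGammaT_ne_zero t (by linarith : s.im ≠ 0)) (norm_le_zero_iff.1 this)
  have hG : ∀ a b : ℝ, ∃ y : ℝ, ∀ s : ℂ, a ≤ s.re → s.re ≤ b → y ≤ s.im → DifferentiableAt ℂ G s := by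
    intro a b
    by_cases hab : a ≤ b
    · obtain ⟨y₁, hy₁, h⟩ := hγ'ne a b hab
      refine ⟨y₁, fun s h1 h2 h3 ↦ ?_⟩
      have hs : 0 < s.im := by linarith
      exact ((hF'an s hs).differentiableAt).div ((hγ'an s hs).differentiableAt) (h s h1 h2 h3)
    · exact ⟨0, fun s h1 h2 _ ↦ absurd (h1.trans h2) hab⟩
  have happ : ∀ a b : ℝ, a ≤ b → ∀ ε : ℝ, 0 < ε → ∃ y₀ : ℝ, ∀ s : ℂ, a ≤ s.re → s.re ≤ b →
      y₀ ≤ s.im → ‖G s - zetaDeformed t s‖ ≤ ε := by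
    intro a b hab ε hε
    obtain ⟨y₀, hy₀⟩ := happD a b hab ε hε
    obtain ⟨y₁, hy₁, h⟩ := hγ'ne a b hab
    refine ⟨max y₀ y₁, fun s h1 h2 h3 ↦ ?_⟩
    have hne := h s h1 h2 ((le_max_right _ _).trans h3)
    have key := hy₀ s h1 h2 ((le_max_left _ _).trans h3)
    have : G s - zetaDeformed t s =
        (deriv (dobnerGammaT t) s)⁻¹ * (deriv F s - deriv (dobnerGammaT t) s * zetaDeformed t s) := by
      simp only [hGdef]
      field_simp
    rw [this, norm_mul, norm_inv]
    calc ‖deriv (dobnerGammaT t) s‖⁻¹ * ‖deriv F s - deriv (dobnerGammaT t) s * zetaDeformed t s‖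
        ≤ ‖deriv (dobnerGammaT t) s‖⁻¹ * (ε * ‖deriv (dobnerGammaT t) s‖) := by gcongr
      _ = ε := by field_simp [norm_ne_zero_iff.2 hne]
  obtain ⟨a, b, hab⟩ := exists_zero_of_strip_approx ht G hG happ
  -- choose the height so that `Re J_t > (1+M)/2 + 1` and `γ_t′ ≠ 0`
  set A : ℝ := 4 / |t| * ((M + 1) / 2 + 1 - a) with hA
  by_cases hab' : a ≤ b
  swap
  · obtain ⟨s, h1, h2, -, -⟩ := hab 0
    exact absurd (h1.trans h2) hab'
  obtain ⟨y₁, hy₁, hγ1⟩ := hγ'ne a b hab'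
  obtain ⟨s, hsa, hsb, hsY, hGs⟩ := hab (max (2 * Real.pi * Real.exp A + 1) y₁)
  have hs_im : 0 < s.im := lt_of_lt_of_le hy₁ ((le_max_right _ _).trans hsY)
  have hγne : deriv (dobnerGammaT t) s ≠ 0 := hγ1 s hsa hsb ((le_max_right _ _).trans hsY)
  -- `G s = 0` ⇒ `F′(s) = 0` ⇒ `ξ_t′(J_t s) · J_t′(s) = 0`
  have hF0 : deriv F s = 0 := by
    simp only [hGdef, div_eq_zero_iff] at hGs
    exact hGs.resolve_right hγne
  have hJ := hasDerivAt_dobnerJ t hs_im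
  have hchain : HasDerivAt F (8 * (deriv (deBruijnH t) (-I * (2 * dobnerJ t s - 1)) * (-I * 2)) *
      (1 + (|t| / 4 : ℝ) * s⁻¹)) s := (hasDerivAt_xiDeformed t (dobnerJ t s)).comp s hJ
  rw [hchain.deriv] at hF0
  have hs0 : s ≠ 0 := fun h ↦ by simp [h] at hs_im
  have hJ'ne : (1 + (|t| / 4 : ℝ) * s⁻¹ : ℂ) ≠ 0 := by
    intro h
    have h2 : s + ((|t| / 4 : ℝ) : ℂ) = 0 := by
      have := congrArg (fun z ↦ s * z) h
      simp only [mul_add, mul_one, mul_zero] at this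
      rwa [mul_left_comm, mul_inv_cancel₀ hs0, mul_one] at this
    have := congrArg Complex.im h2
    simp at this
    linarith
  have hH0 : deriv (deBruijnH t) (-I * (2 * dobnerJ t s - 1)) = 0 := by
    rcases mul_eq_zero.1 hF0 with h | h
    · rcases mul_eq_zero.1 h with h' | h'
      · norm_num at h'
      · rcases mul_eq_zero.1 h' with h'' | h''
        · exact h''
        · exact absurd h'' (mul_ne_zero (neg_ne_zero.2 I_ne_zero) two_ne_zero)
    · exact absurd h hJ'ne
  refine ⟨_, hH0, ?_⟩
  rw [im_neg_I_mul, dobnerJ_re]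
  -- `Re J_t(s) > (1+M)/2`
  have hnorm : 2 * Real.pi * Real.exp A + 1 ≤ ‖s‖ := by
    have h1 : s.im ≤ ‖s‖ := (le_abs_self _).trans (abs_im_le_norm s)
    linarith [(le_max_left _ _).trans hsY]
  have hpos : 0 < 2 * Real.pi * Real.exp A := by positivity
  have hn0 : 0 < ‖s‖ / (2 * Real.pi) := div_pos (by linarith) (by positivity)
  have hlog : A < Real.log (‖s‖ / (2 * Real.pi)) := by
    rw [Real.lt_log_iff_exp_lt hn0, lt_div_iff₀ (by positivity)]
    linarith
  have hkey : (M + 1) / 2 + 1 - a < |t| / 4 * Real.log (‖s‖ / (2 * Real.pi)) := by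
    have := mul_lt_mul_of_pos_left hlog (by positivity : (0 : ℝ) < |t| / 4)
    rwa [show |t| / 4 * A = (M + 1) / 2 + 1 - a by rw [hA]; field_simp] at this
  linarith

/-- **FAR PAIRS (g5).** For every `t < 0` and every depth `M`, `(H_t)′` has a zero with `Im z < −M`: the Dobner-route
witnesses of `Λ^{(1)} ≥ 0` lie arbitrarily deep below the real axis (they come from `Re J_t(s) = Re s + (|t|/4)log|s/2π| → ∞`
along a fixed vertical strip, `Im z = 1 − 2 Re J_t(s)`).  Nothing here is a claim about RH. -/
theorem deriv_deBruijnH_zero_im_lt (t : ℝ) (ht : t < 0) (M : ℝ) :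
    ∃ z : ℂ, deriv (deBruijnH t) z = 0 ∧ z.im < -M :=
  deriv_zero_im_lt_of ht (fun a b hab K ↦ dobnerGammaT_deriv_growth ht a b hab K)
    (fun a b hab ε hε ↦ xiDeformed_deriv_approx ht a b hab ε hε) M

/-- Corollary: the imaginary parts of the zeros of `(H_t)′` (`t < 0`) are UNBOUNDED (conjugation symmetry would also give zeros with
`Im z > M`; we record only unboundedness of `|Im|`). -/
theorem deriv_deBruijnH_zeros_im_unbounded (t : ℝ) (ht : t < 0) :
    ¬ ∃ M : ℝ, ∀ z : ℂ, deriv (deBruijnH t) z = 0 → |z.im| ≤ M := by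
  rintro ⟨M, hM⟩
  obtain ⟨z, hz, hzim⟩ := deriv_deBruijnH_zero_im_lt t ht |M|
  have := hM z hz
  have h2 : -z.im ≤ |z.im| := neg_le_abs _
  linarith [abs_nonneg M, le_abs_self M]

end Summit.RiemannHypothesis.RiemannHypothesis.Theorems.Splittings.JensenX4NewmanDerivDepth

end
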